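import Mathlib.Tactic
import Literature.Computability.Cryptography.ClassBQP
import Literature.Computability.Cryptography.ClassBQPProofs
import Literature.Computability.Complexity.LengthCompare
import Literature.Computability.Complexity.BranchingFn
import Literature.Computability.Complexity.Promise
import Literature.Computability.QuantumComplexity.ForrelationComplete
import Literature.Computability.QuantumComplexity.ForrelationCompleteHolds
import Literature.Algebra.EuclideanLattices.QuantumHardnessWall
import Summits.QuantumAdvantage.QuantumAdvantage.Statement
import Summits.QuantumAdvantage.QuantumAdvantage.Theorems.SoloInformedPseudoDeterministicLift
import Summits.QuantumAdvantage.QuantumAdvantage.Theorems.SoloInformedDecidablePromise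
import Summits.QuantumAdvantage.QuantumAdvantage.Theorems.SoloInformedHardLanguage
import HarnessLib

/-!
# SoloInformedGappedEnlargement — `promiseLift BQP` = problems with a gapped `BQP`-decidable enlargement of the promise

Solo seat `solo-QuantumAdvantage-informed` (ideation tier, summit-directed). A sharpening of
`SoloInformedDecidablePromise` (pointwise `Q-EXT` for `BQP`-decidable promises) into a CHARACTERISATION of the
middle class of the seat's sandwich `PromiseBPP ⊆ promiseLift BQP ⊆ PromiseBQP`:

* **`mem_promiseLift_BQP_of_gappedEnlargement`** — if a uniform oracle-free family `F` decides `Q` on its promise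
  and stays GAPPED (`p_F ∉ (1/3, 2/3)`) on some `BQP` language `D ⊇ Q.yes ∪ Q.no`, then `Q ∈ promiseLift BQP`
  (apply the decidable-promise theorem to the enlarged problem `⟨D ∩ {2/3 ≤ p_F}, D ∩ {p_F ≤ 1/3}⟩`, whose promise
  set is exactly `D`);
* **`exists_gappedEnlargement_of_mem_promiseLift_BQP`** — conversely a lifting language's own `BQP` family is
  gapped on `D = univ`; so **`mem_promiseLift_BQP_iff_gappedEnlargement`**: `Q ∈ promiseLift BQP` iff SOME quantum
  algorithm for `Q` is gapped on SOME `BQP`-decidable superset of the promise — the obstruction to `Q-EXT` at a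
  problem `Q` is that every quantum algorithm for `Q` loses its gap on every `BQP`-decidable enlargement of the promise;
* **`promiseIsLift_iff_kForrelation_gappedEnlargement`** — with Aaronson–Ambainis' complete problem (named fact
  `aaronson_ambainis_kForrelation_complete`), `Q-EXT` iff poly-fold Forrelation admits such a gapped enlargement;
* **`promiseIsLift_of_complete_decidablePromise`** — in particular a `PromiseBQP`-complete problem whose promise
  set is `BQP`-decidable would give `Q-EXT` outright (files 7 + 8);
* `promiseIsLift_iff_eq` — `Q-EXT ↔ promiseLift BQP = PromiseBQP` (with the library's
  `promiseLift_BQP_subset_promiseBQP`); `mem_promiseLift_BQP_of_polyTimeReducible` — the middle class is closed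
  downward under Karp reductions of promise problems;
* **unconditional forms** — the named fact is DISCHARGED in the tree
  (`aaronson_ambainis_kForrelation_complete_holds`, `ForrelationCompleteHolds.lean`), so the equivalences of
  `SoloInformedHardLanguage` hold outright: `promiseIsLift_iff_hardLanguage'`, `promiseIsLift_iff_kForrelation_lifts'`
  (`Q-EXT ↔` poly-fold Forrelation is solved by a `BQP` language), `exists_complete_language_of_promiseIsLift''`
  (`Q-EXT ⇒ BQP` has a Karp-complete language), and `quantumAdvantage_iff_of_kForrelation_lift`
  (for any `BQP` language `L` agreeing with poly-fold Forrelation on its promise, `QuantumAdvantage ↔ L ∉ BPP`).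

[cite: Goldreich2006, Def. 1.2 and Def. 1.4] [cite: Watrous2009, §III.2 and §IV.3]
[cite: AaronsonAmbainis2018, §1.2 and §6 (Prop. 6, Thm. 25)] [cite: BernsteinVazirani1997, Def. 8]
-/

noncomputable section

namespace Summit.QuantumAdvantage.QuantumAdvantage.Theorems

open _root_.Computability Literature.Computability.Complexity Literature.Computability.Cryptography
  Literature.Computability.QuantumComplexity

/-- **A gapped `BQP`-decidable enlargement of the promise lifts the problem.** If `F` (uniform, oracle-free)
accepts `Q.yes` with probability `≥ 2/3` and `Q.no` with probability `≤ 1/3`, and on a `BQP` language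
`D ⊇ Q.yes ∪ Q.no` its acceptance probability avoids `(1/3, 2/3)`, then `Q ∈ promiseLift BQP` — the lifting
language is the yes-part of the enlarged problem, in `BQP` by `yes_mem_BQP_of_promise_mem_BQP`.
[cite: Goldreich2006, Def. 1.2] [cite: Watrous2009, §III.2] -/
theorem mem_promiseLift_BQP_of_gappedEnlargement {Q : PromiseProblem} {F : QCircuitFamily cliffordT}
    (hF : F.IsOracleFree) (hU : F.IsUniform)
    (hyes : ∀ x ∈ Q.yes, 2 / 3 ≤ F.acceptProbOn 0 x) (hno : ∀ x ∈ Q.no, F.acceptProbOn 0 x ≤ 1 / 3)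
    {D : Language Bool} (hD : D ∈ BQP) (hQD : ∀ x, x ∈ Q.yes ∨ x ∈ Q.no → x ∈ D)
    (hgap : ∀ x ∈ D, F.acceptProbOn 0 x ≤ 1 / 3 ∨ 2 / 3 ≤ F.acceptProbOn 0 x) :
    Q ∈ promiseLift BQP := by
  set Q' : PromiseProblem :=
    ⟨{x | x ∈ D ∧ 2 / 3 ≤ F.acceptProbOn 0 x}, {x | x ∈ D ∧ F.acceptProbOn 0 x ≤ 1 / 3}⟩ with hQ'def
  have hQ' : Q' ∈ PromiseBQP := ⟨F, hF, hU, fun x hx => hx.2, fun x hx => hx.2⟩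
  have hSD : ({x | x ∈ Q'.yes ∨ x ∈ Q'.no} : Language Bool) = D := by
    refine Set.ext fun x => ⟨?_, fun h => ?_⟩
    · rintro (⟨h, _⟩ | ⟨h, _⟩) <;> exact h
    · rcases hgap x h with h' | h'
      · exact Or.inr ⟨h, h'⟩
      · exact Or.inl ⟨h, h'⟩
  have hS : ({x | x ∈ Q'.yes ∨ x ∈ Q'.no} : Language Bool) ∈ BQP := by rw [hSD]; exact hD
  refine ⟨Q'.yes, yes_mem_BQP_of_promise_mem_BQP hQ' hS, fun x hx => ⟨hQD x (Or.inl hx), hyes x hx⟩,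
    fun x hx => ?_⟩
  rintro ⟨_, h⟩
  have h' := hno x hx
  linarith

/-- **Conversely, a lifting language is gapped everywhere**: if `Q ∈ promiseLift BQP` then the `BQP` family of a
lifting language decides `Q` on the promise and is gapped on `D = Set.univ ∈ BQP`. [cite: BernsteinVazirani1997, Def. 8]
[cite: Goldreich2006, Def. 1.2] -/
theorem exists_gappedEnlargement_of_mem_promiseLift_BQP {Q : PromiseProblem} (h : Q ∈ promiseLift BQP) :
    ∃ F : QCircuitFamily cliffordT, F.IsOracleFree ∧ F.IsUniform ∧
      (∀ x ∈ Q.yes, 2 / 3 ≤ F.acceptProbOn 0 x) ∧ (∀ x ∈ Q.no, F.acceptProbOn 0 x ≤ 1 / 3) ∧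
      ∃ D ∈ BQP, (∀ x, x ∈ Q.yes ∨ x ∈ Q.no → x ∈ D) ∧
        ∀ x ∈ D, F.acceptProbOn 0 x ≤ 1 / 3 ∨ 2 / 3 ≤ F.acceptProbOn 0 x := by
  obtain ⟨L, hL, hyes, hno⟩ := h
  obtain ⟨F, hF, hU, hFL⟩ := hL
  have hin : ∀ x, x ∈ L → 2 / 3 ≤ F.acceptProbOn 0 x := fun x hx => by
    have := (hFL x).1 hx; norm_num at this ⊢; exact this
  have hout : ∀ x, x ∉ L → F.acceptProbOn 0 x ≤ 1 / 3 := fun x hx => (hFL x).2 hx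
  refine ⟨F, hF, hU, fun x hx => hin x (hyes hx), fun x hx => hout x (hno hx), Set.univ, ?_,
    fun x _ => Set.mem_univ x, fun x _ => ?_⟩
  · -- `univ ∈ P ⊆ BQP` (constant-`[true]` transducer; `P_subset_BQP_holds`)
    exact P_subset_BQP_holds (mem_P_of_mem_FP (const_mem_FP [true]) _ fun w =>
      ⟨fun _ => rfl, fun h => (h (Set.mem_univ w)).elim⟩)
  · by_cases hx : x ∈ L
    · exact Or.inr (hin x hx)
    · exact Or.inl (hout x hx)

/-- **Characterisation of the middle class.** `Q ∈ promiseLift BQP` iff some uniform oracle-free family decides `Q`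
on its promise AND is gapped on some `BQP` language containing the promise. [cite: Goldreich2006, Def. 1.2]
[cite: Watrous2009, §III.2] -/
theorem mem_promiseLift_BQP_iff_gappedEnlargement {Q : PromiseProblem} :
    Q ∈ promiseLift BQP ↔
      ∃ F : QCircuitFamily cliffordT, F.IsOracleFree ∧ F.IsUniform ∧
        (∀ x ∈ Q.yes, 2 / 3 ≤ F.acceptProbOn 0 x) ∧ (∀ x ∈ Q.no, F.acceptProbOn 0 x ≤ 1 / 3) ∧
        ∃ D ∈ BQP, (∀ x, x ∈ Q.yes ∨ x ∈ Q.no → x ∈ D) ∧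
          ∀ x ∈ D, F.acceptProbOn 0 x ≤ 1 / 3 ∨ 2 / 3 ≤ F.acceptProbOn 0 x :=
  ⟨exists_gappedEnlargement_of_mem_promiseLift_BQP,
    fun ⟨_, hF, hU, hyes, hno, _, hD, hQD, hgap⟩ =>
      mem_promiseLift_BQP_of_gappedEnlargement hF hU hyes hno hD hQD hgap⟩

/-- **`Q-EXT` iff poly-fold Forrelation has a gapped `BQP`-decidable enlargement of its promise** (given
Aaronson–Ambainis' completeness, named fact `aaronson_ambainis_kForrelation_complete`; combine
`promiseIsLift_iff_kForrelation_lifts` with the characterisation above).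
[cite: AaronsonAmbainis2018, §1.2 and §6 (Prop. 6, Thm. 25)] [cite: Goldreich2006, Def. 1.2 and Def. 1.4] -/
theorem promiseIsLift_iff_kForrelation_gappedEnlargement (hAA : aaronson_ambainis_kForrelation_complete) :
    PromiseBQP ⊆ promiseLift BQP ↔
      ∃ F : QCircuitFamily cliffordT, F.IsOracleFree ∧ F.IsUniform ∧
        (∀ x ∈ kForrelationProblem.yes, 2 / 3 ≤ F.acceptProbOn 0 x) ∧
        (∀ x ∈ kForrelationProblem.no, F.acceptProbOn 0 x ≤ 1 / 3) ∧
        ∃ D ∈ BQP, (∀ x, x ∈ kForrelationProblem.yes ∨ x ∈ kForrelationProblem.no → x ∈ D) ∧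
          ∀ x ∈ D, F.acceptProbOn 0 x ≤ 1 / 3 ∨ 2 / 3 ≤ F.acceptProbOn 0 x :=
  (promiseIsLift_iff_kForrelation_lifts hAA).trans mem_promiseLift_BQP_iff_gappedEnlargement

/-- **A `PromiseBQP`-complete problem with a `BQP`-decidable promise set gives `Q-EXT`** (the decidable-promise
theorem `mem_promiseLift_BQP_of_promise_mem_BQP` at the complete problem, then `promiseIsLift_iff_complete_lifts`).
[cite: Goldreich2006, Def. 1.2 and Def. 1.4] [cite: Watrous2009, §III.2 and §IV.3] -/
theorem promiseIsLift_of_complete_decidablePromise {Pc : PromiseProblem} (hPc : Pc ∈ PromiseBQP)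
    (hhard : ∀ Q ∈ PromiseBQP, Q.PolyTimeReducible Pc)
    (hS : ({x | x ∈ Pc.yes ∨ x ∈ Pc.no} : Language Bool) ∈ BQP) : PromiseBQP ⊆ promiseLift BQP :=
  (promiseIsLift_iff_complete_lifts hPc hhard).2 (mem_promiseLift_BQP_of_promise_mem_BQP hPc hS)

/-- In particular (Aaronson–Ambainis): if the promise set of poly-fold Forrelation were a `BQP` language, `Q-EXT`
would follow, and with it `QuantumAdvantage ↔ PSep`. [cite: AaronsonAmbainis2018, §6 (Prop. 6, Thm. 25)] -/
theorem promiseIsLift_of_kForrelation_decidablePromise (hAA : aaronson_ambainis_kForrelation_complete)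
    (hS : ({x | x ∈ kForrelationProblem.yes ∨ x ∈ kForrelationProblem.no} : Language Bool) ∈ BQP) :
    PromiseBQP ⊆ promiseLift BQP :=
  promiseIsLift_of_complete_decidablePromise hAA.1 hAA.2 hS

/-- **`Q-EXT` is an equality of classes**: `PromiseBQP ⊆ promiseLift BQP ↔ promiseLift BQP = PromiseBQP`
(the inclusion `promiseLift BQP ⊆ PromiseBQP` is the library's `promiseLift_BQP_subset_promiseBQP`).
[cite: Watrous2009, §III.2] [cite: Goldreich2006, Def. 1.2] -/
theorem promiseIsLift_iff_eq : PromiseBQP ⊆ promiseLift BQP ↔ promiseLift BQP = PromiseBQP :=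
  ⟨fun h => Set.Subset.antisymm Literature.Algebra.EuclideanLattices.promiseLift_BQP_subset_promiseBQP h,
    fun h => h.ge⟩

/-- **The middle class is closed downward under Karp reductions of promise problems**:
`Q₁ ≤ₚ Q₂ ∈ promiseLift BQP ⇒ Q₁ ∈ promiseLift BQP` (compose the reduction with the lifting language and take the
preimage, `mem_promiseLift_BQP_of_polyTimeReducible_ofLanguage`). [cite: Goldreich2006, Def. 1.2 and Def. 1.4] -/
theorem mem_promiseLift_BQP_of_polyTimeReducible {Q₁ Q₂ : PromiseProblem} (h : Q₁.PolyTimeReducible Q₂)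
    (h₂ : Q₂ ∈ promiseLift BQP) : Q₁ ∈ promiseLift BQP := by
  obtain ⟨L, hL, hyes, hno⟩ := h₂
  obtain ⟨f, hf, hfy, hfn⟩ := h
  exact mem_promiseLift_BQP_of_polyTimeReducible_ofLanguage
    ⟨f, hf, fun x hx => hyes (hfy hx), fun x hx => hno (hfn hx)⟩ hL

/-! ### Unconditional forms (Aaronson–Ambainis completeness is proved in the tree) -/

/-- **`Q-EXT ⟺ BQP contains a PromiseBQP-hard language`**, unconditionally
(`aaronson_ambainis_kForrelation_complete_holds`). [cite: AaronsonAmbainis2018, §6 (Prop. 6, Lemma 24, Thm. 25)]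
[cite: Goldreich2006, Def. 1.4] -/
theorem promiseIsLift_iff_hardLanguage' :
    PromiseBQP ⊆ promiseLift BQP ↔
      ∃ L ∈ BQP, ∀ Q ∈ PromiseBQP, Q.PolyTimeReducible (PromiseProblem.ofLanguage L) :=
  promiseIsLift_iff_hardLanguage aaronson_ambainis_kForrelation_complete_holds

/-- **`Q-EXT ⟺` explicit poly-fold Forrelation is solved by a `BQP` language**, unconditionally.
[cite: AaronsonAmbainis2018, §6 (Prop. 6, Lemma 24, Thm. 25)] [cite: Goldreich2006, Def. 1.2] -/
theorem promiseIsLift_iff_kForrelation_lifts' :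
    PromiseBQP ⊆ promiseLift BQP ↔ kForrelationProblem ∈ promiseLift BQP :=
  promiseIsLift_iff_kForrelation_lifts aaronson_ambainis_kForrelation_complete_holds

/-- **`Q-EXT ⇒ BQP` has a Karp-complete language**, unconditionally. [cite: AaronsonAmbainis2018, §6 (Thm. 25)]
[cite: Watrous2009, §IV.1–IV.3] -/
theorem exists_complete_language_of_promiseIsLift'' (hExt : PromiseBQP ⊆ promiseLift BQP) :
    ∃ L ∈ BQP, PromiseProblem.IsHard BQP (PromiseProblem.ofLanguage L) :=
  exists_complete_language_of_promiseIsLift' aaronson_ambainis_kForrelation_complete_holds hExt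

/-- **`Q-EXT` iff poly-fold Forrelation has a gapped `BQP`-decidable enlargement of its promise**, unconditionally.
[cite: AaronsonAmbainis2018, §6 (Prop. 6, Thm. 25)] [cite: Goldreich2006, Def. 1.2] -/
theorem promiseIsLift_iff_kForrelation_gappedEnlargement' :
    PromiseBQP ⊆ promiseLift BQP ↔
      ∃ F : QCircuitFamily cliffordT, F.IsOracleFree ∧ F.IsUniform ∧
        (∀ x ∈ kForrelationProblem.yes, 2 / 3 ≤ F.acceptProbOn 0 x) ∧
        (∀ x ∈ kForrelationProblem.no, F.acceptProbOn 0 x ≤ 1 / 3) ∧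
        ∃ D ∈ BQP, (∀ x, x ∈ kForrelationProblem.yes ∨ x ∈ kForrelationProblem.no → x ∈ D) ∧
          ∀ x ∈ D, F.acceptProbOn 0 x ≤ 1 / 3 ∨ 2 / 3 ≤ F.acceptProbOn 0 x :=
  promiseIsLift_iff_kForrelation_gappedEnlargement aaronson_ambainis_kForrelation_complete_holds

/-- If the promise set of poly-fold Forrelation were a `BQP` language, `Q-EXT` would follow — unconditionally in the
completeness. [cite: AaronsonAmbainis2018, §6 (Prop. 6, Thm. 25)] -/
theorem promiseIsLift_of_kForrelation_decidablePromise'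
    (hS : ({x | x ∈ kForrelationProblem.yes ∨ x ∈ kForrelationProblem.no} : Language Bool) ∈ BQP) :
    PromiseBQP ⊆ promiseLift BQP :=
  promiseIsLift_of_kForrelation_decidablePromise aaronson_ambainis_kForrelation_complete_holds hS

/-- **The summit at one language.** For ANY `BQP` language `L` that agrees with explicit poly-fold Forrelation on
its promise, `QuantumAdvantage ↔ L ∉ BPP` (such an `L` is automatically `BQP`-complete). Unconditional.
[cite: AaronsonAmbainis2018, §6 (Thm. 25)] [cite: AroraBarakCC2009, §7.6 (Def. 7.16)] -/
theorem quantumAdvantage_iff_of_kForrelation_lift {L : Language Bool} (hL : L ∈ BQP)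
    (hyes : kForrelationProblem.yes ≤ L) (hno : kForrelationProblem.no ≤ Lᶜ) :
    QuantumAdvantage ↔ L ∉ BPP :=
  quantumAdvantage_iff_of_complete_lift aaronson_ambainis_kForrelation_complete_holds.2 hL hyes hno

end Summit.QuantumAdvantage.QuantumAdvantage.Theorems

end
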